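import Mathlib
import Summits.KontsevichZagierPeriods.KontsevichZagierPeriods.Theorems.InverseLandauTateLiftingAffineChart
import Summits.KontsevichZagierPeriods.KontsevichZagierPeriods.Theorems.InverseLandauTateLiftingRotationBalls
import Summits.KontsevichZagierPeriods.KontsevichZagierPeriods.Theorems.InverseLandauTateLiftingGenusZeroSector
import Literature.NumberTheory.Transcendental.KZLogCalculusProofs

/-!
# `TateLifting` (stmt-KontsevichZagierPeriods-9129), line `Sketch` — stub 57 `EllipsoidKernel`:
# ellipsoids adjoined to the ball sector

An ELLIPSOID representation is an integrand-`1` representation `[E, 1]` over the affine image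
`E = (x ↦ A x + b) '' B̄_n` of the closed unit ball `B̄_n = {x | Σ xᵢ² ≤ 1}` of any dimension `n`, with
real-algebraic `A` (`det A ≠ 0`) and `b`. ONE change of variables (Kontsevich–Zagier's rule (2)) along the
affine map — the landed affine engine `tateLifting_affineChart` — relates `[E, 1]` to the honest pull-back
`[{x | A x + b ∈ E}, |det A| · 1] = [B̄_n, |det A|]`, which is a RADIAL BALL GENERATOR of the landed ball
sector (`ballKernel`) with the constant `K`-polynomial `P = C |det A|` (`|det A| ∈ K = ℚ̄ ∩ ℝ` since
`det A` is algebraic). The kernel transfer `GenusZero.kernel_of_reduce` then gives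

* `tateLifting_ellipsoidKernel` — **Conjecture 1 (kernel form) on the subgroup generated by the ellipsoids
  of all dimensions, the radial balls `[B̄_n, P(|x|²)]`, the points and the disc `[π]`**: every vanishing
  `ℤ`-combination of these generators is a relation of the Kontsevich–Zagier calculus (Lindemann inside,
  through `ballKernel`). E.g. `vol E = |det A| · vol B̄_n`-type identities between ellipsoids of different
  dimensions are derivable by the moves once the volumes agree.

Design: no definitions (generator classes are written out in the statements). References: M. Kontsevich,
D. Zagier, *Periods* (2001), §1.2 rules (1), (2).
-/

noncomputable section

namespace Summit.KontsevichZagierPeriods.InverseLandau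

open Set
open Literature.NumberTheory.Transcendental

namespace Ellipsoid

/-- **An ellipsoid is a constant-density ball modulo relations**: for real-algebraic `A` (`det A ≠ 0`), `b`
and an integrand-`1` representation `r` over `(x ↦ A x + b) '' B̄_n`, the honest affine pull-back
(`tateLifting_affineChart`) is a representation over the closed unit ball `B̄_n` whose integrand is the
constant `K`-polynomial `C |det A|` read radially, and `[r]` minus it lies in `KZ.relations`.
[cite: KontsevichZagier2001, §1.2 rule (2)] -/
theorem toBall {n : ℕ} (A : Matrix (Fin n) (Fin n) ℝ) (b : Fin n → ℝ) (r : KZ.IntegralRep n)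
    (hA : ∀ i j, IsAlgebraic ℚ (A i j)) (hb : ∀ i, IsAlgebraic ℚ (b i)) (hdet : A.det ≠ 0)
    (hdom : r.domain = (fun x => A.mulVec x + b) '' {x | ∑ i, x i ^ 2 ≤ 1})
    (hint : ∀ y ∈ r.domain, r.integrand y = 1) :
    ∃ (P : Polynomial (algebraicClosure ℚ ℝ)) (r' : KZ.IntegralRep n),
      r'.domain = {x | ∑ i, x i ^ 2 ≤ 1} ∧
      Set.EqOn r'.integrand (fun x => (Polynomial.aeval (∑ i, x i ^ 2) P : ℝ)) r'.domain ∧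
      KZ.of r - KZ.of r' ∈ KZ.relations := by
  obtain ⟨hdetalg, hmove, -⟩ := tateLifting_affineChart n A b hA hb hdet
  obtain ⟨r', hd', hi', hrel⟩ := hmove r
  -- the constant Jacobian `|det A|` is real-algebraic, i.e. an element `c` of `K = algebraicClosure ℚ ℝ`
  have habs : IsAlgebraic ℚ |A.det| := by
    rcases abs_choice A.det with h | h
    · rw [h]; exact hdetalg
    · rw [h]; exact hdetalg.neg
  obtain ⟨c, hc⟩ : ∃ c : algebraicClosure ℚ ℝ, (c : ℝ) = |A.det| :=
    ⟨⟨|A.det|, mem_algebraicClosure_iff.mpr habs⟩, rfl⟩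
  -- the pulled-back domain `{x | A x + b ∈ (A · + b) '' B̄_n}` is the ball (injectivity)
  have hdom' : r'.domain = {x | ∑ i, x i ^ 2 ≤ 1} := by
    rw [hd', hdom]
    exact (AffineEngine.affine_injective b hdet).preimage_image _
  refine ⟨Polynomial.C c, r', hdom', fun x hx => ?_, hrel⟩
  have hmem : A.mulVec x + b ∈ r.domain := by
    rw [hd'] at hx
    exact hx
  show r'.integrand x = (Polynomial.aeval (∑ i, x i ^ 2) (Polynomial.C c) : ℝ)
  rw [hi', Polynomial.aeval_C, IntermediateField.algebraMap_apply, hc]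
  show |A.det| * r.integrand (A.mulVec x + b) = |A.det|
  rw [hint _ hmem, mul_one]

end Ellipsoid

/-- **ELLIPSOID KERNEL** (stub 57 of line `Sketch`): **Conjecture 1 (kernel form) on the subgroup generated
by the ellipsoids `[(A · + b) '' B̄_n, 1]` (real-algebraic `A ∈ GL_n`, `b`; all `n`), the radial ball
representations `[B̄_n, P(|x|²)]` (`P ∈ K[X]`), the point representations and the disc `[π]`.** Every
vanishing `ℤ`-combination of these generators is a relation of the Kontsevich–Zagier calculus: each
ellipsoid is one affine move (rule (2), `Ellipsoid.toBall`) away from a constant-density ball, and the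
kernel form on the ball sector is `ballKernel` (kernel transfer `GenusZero.kernel_of_reduce`).
[cite: KontsevichZagier2001, §1.2 rule (2)] -/
theorem tateLifting_ellipsoidKernel :
  ∀ c ∈ AddSubgroup.closure
      ({d : KZ.FormalRep | ∃ (n : ℕ) (A : Matrix (Fin n) (Fin n) ℝ) (b : Fin n → ℝ) (r : KZ.IntegralRep n),
          (∀ i j, IsAlgebraic ℚ (A i j)) ∧ (∀ i, IsAlgebraic ℚ (b i)) ∧ A.det ≠ 0 ∧
          r.domain = (fun x => A.mulVec x + b) '' {x | ∑ i, x i ^ 2 ≤ 1} ∧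
          (∀ y ∈ r.domain, r.integrand y = 1) ∧ d = KZ.of r} ∪
        ({d : KZ.FormalRep | ∃ (n : ℕ) (P : Polynomial (algebraicClosure ℚ ℝ)) (r : KZ.IntegralRep n),
            r.domain = {x | ∑ i, x i ^ 2 ≤ 1} ∧
            Set.EqOn r.integrand (fun x => (Polynomial.aeval (∑ i, x i ^ 2) P : ℝ)) r.domain ∧ d = KZ.of r} ∪
          {d : KZ.FormalRep | ∃ r : KZ.IntegralRep 0, d = KZ.of r} ∪ {KZ.of KZ.piRep})),
    KZ.eval c = 0 → c ∈ KZ.relations := by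
  refine GenusZero.kernel_of_reduce (fun d hd => ?_) ballKernel
  rcases hd with ⟨n, A, b, r, hA, hb, hdet, hdom, hint, rfl⟩ | hL
  · -- an ellipsoid generator: one affine move to a constant-density ball generator
    obtain ⟨P, r', hd', hi', hrel⟩ := Ellipsoid.toBall A b r hA hb hdet hdom hint
    exact ⟨KZ.of r', AddSubgroup.subset_closure (Or.inl (Or.inl ⟨n, P, r', hd', hi', rfl⟩)), hrel⟩
  · -- a generator of the ball sector: the identity reduction
    exact ⟨d, AddSubgroup.subset_closure hL, by rw [sub_self]; exact zero_mem _⟩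

end Summit.KontsevichZagierPeriods.InverseLandau

end
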